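import Summits.HodgeConjecture.CorCM.TwoSexticFieldsFrameTransfer
import HarnessLib

/-!
# COR-CM — TWO sextic CM fields sharing `k`: INDEPENDENT ROTATIONS of the two frames suffice for the transfer to
# the 14-point model (the reflections of `S₃ × C₂` are read off rotations)

Cell `pub-hodgecm2` (COR-CM), seat b30 gen 16 (2026-08-21); COUNT-NEUTRAL; theorems only apart from one bookkeeping
definition (`actRot`, the action of independent rotations with a common sign move on the 14-point model); no named fact,
no `sorry`.  Sequel of `CorCM/TwoSexticFieldsFrameTransfer.lean` in the series TWO-FIELD-PAIR.

THE OBSERVATION.  In the 14-point model `Pt'` of `E × B₁ × B₂` (gen 14, `Census/DihedralSexticPairCurve.lean`) the type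
`phi'` has, on each threefold slot `m`, sign `true` at exactly ONE place.  Hence for every `g = (j, f, d) ∈ S₃ × C₂` acting
diagonally (`act' j f d`) the membership predicate `y ↦ [act' j f d y ∈ phi']` only remembers WHERE the affine map
`p ↦ ±p + j` sends the distinguished place of each slot, and is therefore EQUAL to the predicate of a move by INDEPENDENT
ROTATIONS `p ↦ p + j_m` on the two slots (`actRot`): `j_m = j` if `f = false`, `(j₀, j₁) = (-j, 2 - j)` if `f = true`
(`act'_mem_phi'_iff_actRot`, `decide`).  Consequently the JOINT Galois hypothesis of the two-field transfer can be
weakened from «the six sign-preserving affine moves are realised diagonally» (`he_gal`, which needs both fields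
non-Galois) to «every pair of rotations `(p ↦ p + j₀, p ↦ p + j₁)` is realised jointly» (`he_rot`), which holds for ANY
two non-isomorphic sextic CM fields sharing `k`, Galois or not (`CorCM/TwoSexticFieldsJointRotations.lean`): the image
of `Aut(ℂ/k)` in `S₃ × S₃` is transitive on each factor and has non-trivial kernels, hence contains `A₃ × A₃`.

* §1 `actRot`, `act'_mem_phi'_iff_actRot` (kernel lemma), `exists_ringEquiv_realises_rot`, `comp_mem_iff_actRot_mem_phi'`;
* §2 **`modelBalanced_of_isGaloisBalancedAlg_rot`** — under `he_rot`, for every slot map `κ : Fin N → Fin 3`, an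
  `Aut(ℂ)`-balanced weight of `⨁_j A₃ (κ j)` is a balanced configuration of the 14-point model (gen 15's `ModelBalanced`,
  all twelve diagonal conditions) [cite: GaoUllmo2025, Thm 3.1 (3.2)] [cite: Pohlmann1968, Thm 1].
The assembly for all powers from `he_rot` is `CorCM/TwoSexticFieldsPowersHodgeOfMarkmanRot.lean`.

## References
* [GaoUllmo2025] Z. Gao, E. Ullmo, J. Inst. Math. Jussieu 25 (2025), Thm 3.1.  [Pohlmann1968] H. Pohlmann, Ann. of
  Math. 88 (1968), Thm 1.  [Gordon1999HodgeAVSurvey] B. B. Gordon, CRM Monogr. 10 (1999), §9.2.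
-/

noncomputable section

open CategoryTheory CategoryTheory.Limits NumberField

namespace Summit.HodgeConjecture.CorCM.TwoSexticFields

open Literature.AlgebraicGeometry Literature.AlgebraicGeometry.Motives Literature.AlgebraicGeometry.HodgeTheory
open Literature.AlgebraicGeometry.Pohlmann1968
open Literature.NumberTheory.ComplexMultiplication
open Summit.HodgeConjecture.CorCM.Census.DihedralSexticPair (Pt act phi act_apply mem_phi_iff)
open Summit.HodgeConjecture.CorCM.Census.DihedralSexticPairCurve (Pt' act' phi' act'_inl act'_inr mem_phi'_inl
  mem_phi'_inr)
open Summit.HodgeConjecture.CorCM.Census.DihedralSexticPairCurvePowers (ModelBalanced)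
open Summit.HodgeConjecture.CorCM.DihedralSexticPair (act_mk_apply)
open Summit.HodgeConjecture.CorCM.DihedralSexticPairCurve (comp_eq_iff_of_realises)
open Summit.HodgeConjecture.CorCM.DihedralSexticPairCurvePowers (ncard_sep_eq_card_filter)

/-! ## §1 Independent rotations on the 14-point model -/

section Model

/-- **Independent rotations with a common sign move**: `(j₀, j₁, d)` sends `inl b ↦ inl b^{d}` and
`inr (m, p, b) ↦ inr (m, p + j_m, b^{d})` (`b^{d} = b` if `d`, `¬b` otherwise). [folklore] -/
def actRot (js : Fin 2 → ZMod 3) (d : Bool) : Pt' → Pt'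
  | Sum.inl b => Sum.inl (if d then b else !b)
  | Sum.inr x => Sum.inr (x.1, x.2.1 + js x.1, if d then x.2.2 else !x.2.2)

/-- Unfolding of `actRot` on the curve slot. [folklore] -/
theorem actRot_inl (js : Fin 2 → ZMod 3) (d b : Bool) : actRot js d (Sum.inl b) = Sum.inl (if d then b else !b) := rfl

/-- Unfolding of `actRot` on the threefold slots. [folklore] -/
theorem actRot_inr (js : Fin 2 → ZMod 3) (d : Bool) (m : Fin 2) (p : ZMod 3) (b : Bool) :
    actRot js d (Sum.inr (m, p, b)) = Sum.inr (m, p + js m, if d then b else !b) := rfl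

set_option synthInstance.maxSize 4096 in
set_option synthInstance.maxHeartbeats 400000 in
/-- **The diagonal moves are read off rotations**: for every `(j, d)`, membership in `phi'` after the diagonal move
`act' j f d` equals membership after the independent rotations `(j, j)` if `f = false`, `(-j, 2 - j)` if `f = true`
(the type has one distinguished place per slot). [folklore] -/
theorem act'_mem_phi'_iff_actRot : ∀ (j : ZMod 3) (d : Bool) (y : Pt'),
    (act' j false d y ∈ phi' ↔ actRot (fun _ => j) d y ∈ phi') ∧
      (act' j true d y ∈ phi' ↔ actRot ![-j, 2 - j] d y ∈ phi') := by
  decide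

end Model

open scoped Classical

/-! ## §2 Frame transfer from jointly realised rotations -/

section Transfer

variable {I : Type} {Kf : I → Type} [∀ i, Field (Kf i)]
  {i₀ : I} {tl : Fin 2 → I} {e : ∀ m : Fin 2, (Kf (tl m) →+* ℂ) ≃ ZMod 3 × Bool} {τ : Kf i₀ →+* ℂ}
  (hττ : ComplexEmbedding.conjugate τ ≠ τ) (hk : ∀ σ : Kf i₀ →+* ℂ, σ = τ ∨ σ = ComplexEmbedding.conjugate τ)
  {i : ∀ m : Fin 2, Kf i₀ →+* Kf (tl m)}
  (he_sign : ∀ (m : Fin 2) (s : Kf (tl m) →+* ℂ), s.comp (i m) = τ ↔ (e m s).2 = true)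
  (he_conj : ∀ (m : Fin 2) (s : Kf (tl m) →+* ℂ), e m (ComplexEmbedding.conjugate s) = ((e m s).1, !(e m s).2))
  (he_rot : ∀ js : Fin 2 → ZMod 3, ∃ σ : ℂ ≃+* ℂ, ∀ (m : Fin 2) (s : Kf (tl m) →+* ℂ),
    e m ((σ : ℂ →+* ℂ).comp s) = ((e m s).1 + js m, (e m s).2))

include he_conj he_rot in
/-- Every pair of rotations together with a sign move is realised jointly (compose with complex conjugation).
[cite: Gordon1999HodgeAVSurvey, §9.2 (proof)] -/
theorem exists_ringEquiv_realises_rot (js : Fin 2 → ZMod 3) (d : Bool) :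
    ∃ ρ : ℂ ≃+* ℂ, ∀ (m : Fin 2) (s : Kf (tl m) →+* ℂ),
      e m ((ρ : ℂ →+* ℂ).comp s) = ((e m s).1 + js m, if d then (e m s).2 else !(e m s).2) := by
  obtain ⟨σ, hσ⟩ := he_rot js
  cases d with
  | true => exact ⟨σ, fun m s => by rw [hσ]; rfl⟩
  | false =>
    refine ⟨(starRingAut : ℂ ≃+* ℂ).trans σ, fun m s => ?_⟩
    have hc : (((starRingAut : ℂ ≃+* ℂ).trans σ : ℂ ≃+* ℂ) : ℂ →+* ℂ).comp s =
        (σ : ℂ →+* ℂ).comp (ComplexEmbedding.conjugate s) := RingHom.ext fun _ => rfl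
    rw [hc, hσ, he_conj]
    rfl

variable {Φ₃ : ∀ j : Fin 3, CMType (Kf (slots i₀ tl j))}
  (hΨ : ∀ σ : Kf i₀ →+* ℂ, σ ∈ (Φ₃ 0).1 ↔ σ = τ)
  (hΦ : ∀ (m : Fin 2) (s : Kf (tl m) →+* ℂ), s ∈ (Φ₃ m.succ).1 ↔ (e m s).2 = decide ((e m s).1.val = m.val))

include hττ hk he_sign hΨ hΦ in
/-- **Membership read in the model for a realiser of independent rotations.** [cite: GaoUllmo2025, Thm 3.1 (3.2)] -/
theorem comp_mem_iff_actRot_mem_phi' {ρ : ℂ ≃+* ℂ} {js : Fin 2 → ZMod 3} {d : Bool}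
    (hρ : ∀ (m : Fin 2) (s : Kf (tl m) →+* ℂ),
      e m ((ρ : ℂ →+* ℂ).comp s) = ((e m s).1 + js m, if d then (e m s).2 else !(e m s).2))
    (x : (j : Fin 3) × (Kf (slots i₀ tl j) →+* ℂ)) :
    (ρ : ℂ →+* ℂ).comp x.2 ∈ (Φ₃ x.1).1 ↔ actRot js d (toPt₂ e τ x) ∈ phi' := by
  rcases sigma_cases₂ x with ⟨σ, rfl⟩ | ⟨m, s, rfl⟩
  · change (ρ : ℂ →+* ℂ).comp σ ∈ (Φ₃ 0).1 ↔ _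
    have hρ₀ : ∀ s : Kf (tl 0) →+* ℂ, e 0 ((ρ : ℂ →+* ℂ).comp s) =
        ((if false then -(e 0 s).1 else (e 0 s).1) + js 0, if d then (e 0 s).2 else !(e 0 s).2) := fun s => by
      rw [hρ 0 s]; rfl
    rw [hΨ, toPt₂_zero, actRot_inl, mem_phi'_inl,
      comp_eq_iff_of_realises (e := e 0) (i := i 0) hττ hk (he_sign 0) ρ hρ₀ σ]
  · change (ρ : ℂ →+* ℂ).comp s ∈ (Φ₃ m.succ).1 ↔ _
    rw [hΦ, hρ, toPt₂_succ]
    change _ ↔ actRot js d (Sum.inr (m, (e m s).1, (e m s).2)) ∈ phi'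
    rw [actRot_inr, mem_phi'_inr, mem_phi_iff]

include hττ hk he_sign he_conj he_rot hΨ hΦ in
/-- **FRAME TRANSFER FROM ROTATIONS, FOR ALL POWERS**: if every pair of rotations of the two frames is realised jointly
(`he_rot`), then for every slot map `κ : Fin N → Fin 3` an `Aut(ℂ)`-balanced weight of `⨁_j A₃ (κ j)` is a balanced
configuration of the 14-point model (all twelve diagonal conditions of gen 15's `ModelBalanced`, each being a rotation
condition by `act'_mem_phi'_iff_actRot`). [cite: GaoUllmo2025, Thm 3.1 (3.2)] [cite: Pohlmann1968, Thm 1] -/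
theorem modelBalanced_of_isGaloisBalancedAlg_rot {N : ℕ} (κ : Fin N → Fin 3)
    {S : Finset ((j : Fin N) × (Kf (slots i₀ tl (κ j)) →+* ℂ))}
    (hS : IsGaloisBalancedAlg (K := fun j => Kf (slots i₀ tl (κ j))) (fun j => Φ₃ (κ j)) S) :
    ModelBalanced (fun x => toPt₂ e τ ((Sigma.map κ (fun _ => id) :
      ((j : Fin N) × (Kf (slots i₀ tl (κ j)) →+* ℂ)) → ((m : Fin 3) × (Kf (slots i₀ tl m) →+* ℂ))) x)) S := by
  intro j f d
  -- the rotations reading the diagonal move `(j, f, d)`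
  obtain ⟨js, hjs⟩ : ∃ js : Fin 2 → ZMod 3, ∀ y : Pt', act' j f d y ∈ phi' ↔ actRot js d y ∈ phi' := by
    cases f
    · exact ⟨fun _ => j, fun y => (act'_mem_phi'_iff_actRot j d y).1⟩
    · exact ⟨![-j, 2 - j], fun y => (act'_mem_phi'_iff_actRot j d y).2⟩
  obtain ⟨ρ, hρ⟩ := exists_ringEquiv_realises_rot he_conj he_rot js d
  have h := hS ρ
  rw [ncard_sep_eq_card_filter, ncard_sep_eq_card_filter] at h
  have key : ∀ x : (j : Fin N) × (Kf (slots i₀ tl (κ j)) →+* ℂ),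
      (ρ : ℂ →+* ℂ).comp x.2 ∈ (Φ₃ (κ x.1)).1 ↔ act' j f d (toPt₂ e τ ((Sigma.map κ (fun _ => id) :
        ((j : Fin N) × (Kf (slots i₀ tl (κ j)) →+* ℂ)) → ((m : Fin 3) × (Kf (slots i₀ tl m) →+* ℂ))) x))
          ∈ phi' :=
    fun x => (comp_mem_iff_actRot_mem_phi' hττ hk he_sign hΨ hΦ hρ ⟨κ x.1, x.2⟩).trans (hjs _).symm
  rw [Finset.filter_congr fun x _ => key x, Finset.filter_congr fun x _ => (key x).not] at h
  exact h

end Transfer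

end Summit.HodgeConjecture.CorCM.TwoSexticFields

end
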